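import Literature.NumberTheory.PAdicHodge.LubinTateAinfTorsionLift
import Literature.NumberTheory.PAdicHodge.AinfWeierstrassRamifiedCoeffBridge
import Literature.NumberTheory.PAdicHodge.AinfRamifiedTateModule
import Literature.NumberTheory.GaloisRepresentations.LubinTateDivisionTowerCBall
import Literature.NumberTheory.GaloisRepresentations.LubinTateComparisonDilation
import Literature.NumberTheory.GaloisRepresentations.LubinTateLogarithm
import HarnessLib

/-!
# The Lubin–Tate tower with coefficients in `𝒪_D = ℤ_p[ϖ]`: `[a]_f` over `CoeffDisc D` agrees with `homC`

Topic `Literature/NumberTheory/PAdicHodge`; one DEFINITION (`CoeffDisc.toInt : 𝒪_D → 𝒪_F`) and THEOREMS. Fontaine's element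
`x_t ∈ A_inf(𝒪_D)` (`LubinTateAinfTorsionLift`) is built from a division tower `t` of `P = ϖ_D X + X^q` with coefficients in
the discrete Eisenstein ring `CoeffDisc D` (`ϖ_D ↦ D.root ∈ F`), while the tree's Lubin–Tate tower `ltDivTower hπ` of
`f = πX + X^q` (`GaloisRepresentations.LubinTateDivisionTowerCBall`) is phrased with `[a]_f = homC hπ a` over `𝒪̂_{F^nr}`.
When `π = D.root` (so `P ↦ f` under `𝒪_D → 𝒪_F`) the two readings agree:

* `CoeffDisc.toInt D : CoeffDisc D →+* 𝒪[F]` (`Coeff.toF` co-restricted, tree `Coeff.toF_mem_integer`), `toInt ϖ_D = π`;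
  `map_toInt_ltSeries : P ↦ f`; `map_toInt_hom : [a]_P ↦ [toInt a]_f` (tree `map_hom`, `hom_congr`); `subst_map_hom_ltLog :
  λ_f ∘ [a]_P = (toInt a)·λ_f` over `F` (tree `subst_hom_ltLog`);
* ★ `evalPt₁_homC_toInt : [toInt a]_f(y) = [a]_P(y)` on `𝔪_{ℂ_F}` (`ltSMul` over `CoeffDisc D`; change of coefficients
  `evalPt₁_map_of_algebraMap_eq`);
* consequences for the tower `t = ltDivTower hπ`: **`P(t_{n+1}) = t_n`** as `ltStepC` (`ltStepC_ltDivTower_succ`), and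
  ★ **`σ t = [a]_P t` whenever `toInt a = χ_π(σ)`** (`galSeq_ltDivTower`) — the hypotheses `htp`, `hσ` of
  `ltTorsionLift` / `gal_ltTorsionLift_of_galSeq_eq` (sequel `LubinTateAinfTorsionLiftAction`).

## References
* J. W. S. Cassels, A. Fröhlich (eds.), *Algebraic Number Theory* (1967), Ch. VI §3.5 Prop. 2 (change of coefficients),
  §3.4 Thm. 3. [CasselsFrohlichANT1967]
* E. de Shalit, *Iwasawa theory of elliptic curves with complex multiplication* (1987), Ch. I §2.2. [deShalit1987]
* J.-P. Serre, *Local Fields* (1979), Ch. I §6 Prop. 18. [SerreLocalFields1979]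
* J. Lubin, J. Tate, *Formal complex multiplication in local fields*, Ann. of Math. 81 (1965), §1. [LubinTate1965]
-/

noncomputable section

open Ideal Field WittVector MvPowerSeries ValuativeRel

namespace Literature.NumberTheory.PAdicHodge

open Literature.NumberTheory.GaloisRepresentations
open Literature.NumberTheory.GaloisRepresentations.IsNonarchimedeanLocalField
open Literature.NumberTheory.GaloisRepresentations.LubinTate

variable {F : Type} [Field F] [ValuativeRel F] [TopologicalSpace F] [IsNonarchimedeanLocalField F] [CharZero F]
  {p : ℕ} [Fact p.Prime] {hp : valuation F p < 1} (D : EisensteinRoot F p hp)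

namespace EisensteinRoot

/-! ## §1 `𝒪_D → 𝒪_F` and the change of coefficients `P ↦ f`, `[a]_P ↦ [a]_f` -/

/-- **`𝒪_D → 𝒪_F`** (`Coeff.toF : 𝒪_D → F` co-restricted to the valuation ring). [cite: SerreLocalFields1979, Ch. I §6 Prop. 18] -/
def CoeffDisc.toInt : CoeffDisc D →+* 𝒪[F] :=
  ((Coeff.toF D).comp (CoeffDisc.of D).symm.toRingHom).codRestrict 𝒪[F] fun _ => Coeff.toF_mem_integer D _

/-- Unfolding `toInt` in `F`. [cite: SerreLocalFields1979, Ch. I §6 Prop. 18] -/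
theorem CoeffDisc.coe_toInt (x : D.Coeff) : ((CoeffDisc.toInt D (CoeffDisc.of D x) : 𝒪[F]) : F) = Coeff.toF D x := rfl

/-- The coefficient maps `𝒪_D → 𝒪̂_{F^nr} → 𝒪_{ℂ_F}` and `𝒪_D → 𝒪_{ℂ_F}` agree. [cite: CasselsFrohlichANT1967, Ch. VI §3.2] -/
theorem CoeffDisc.algebraMap_intToUnrCoeff_toInt (a : CoeffDisc D) :
    algebraMap (UnrCoeff F) (CBall F) (((intToUnrCoeff F).comp (CoeffDisc.toInt D)) a) =
      algebraMap (CoeffDisc D) (CBall F) a := by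
  apply Subtype.ext
  rw [RingHom.comp_apply, algebraMap_unrCoeff_coe, intToUnrCoeff, RingHom.comp_apply]
  exact (toC_algebraMap _).trans rfl

variable {π : 𝒪[F]} (hπ : (valuation F).IsUniformizer (π : F)) (hπD : (π : F) = D.root)

include hπD in
/-- `toInt ϖ_D = π` when `π = D.root`. [cite: SerreLocalFields1979, Ch. I §6 Prop. 18] -/
theorem CoeffDisc.toInt_root : CoeffDisc.toInt D (CoeffDisc.of D (AdjoinRoot.root D.poly)) = π :=
  Subtype.ext ((Coeff.toF_root D).trans hπD.symm)

omit [CharZero F] in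
/-- `P = cX + X^q` under a change of coefficients. [cite: CasselsFrohlichANT1967, Ch. VI §3.5 Prop. 2] -/
theorem map_ltSeries {A B : Type*} [CommRing A] [CommRing B] (φ : A →+* B) (c : A) (q : ℕ) :
    (ltSeries c q).map φ = ltSeries (φ c) q := by
  rw [ltSeries_def, ltSeries_def, ← Polynomial.polynomial_map_coe, ltPoly', ltPoly', Polynomial.map_add,
    Polynomial.map_mul, Polynomial.map_pow, Polynomial.map_C, Polynomial.map_X]

include hπD in
/-- **`P ↦ f`**: `ϖ_D X + X^q ∈ 𝒪_D⟦X⟧` maps to the Lubin–Tate polynomial `πX + X^q ∈ 𝒪_F⟦X⟧` (`q = q_F`, `π = D.root`).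
[cite: CasselsFrohlichANT1967, Ch. VI §3.5 Prop. 2] -/
theorem map_toInt_ltSeries :
    (ltSeries (CoeffDisc.of D (AdjoinRoot.root D.poly)) (residueFieldCard F)).map (CoeffDisc.toInt D) =
      ((ltPoly F π : Polynomial 𝒪[F]) : PowerSeries 𝒪[F]) := by
  rw [map_ltSeries, CoeffDisc.toInt_root D hπD, ltSeries_def]
  rfl

variable (hA : IsLTRing (CoeffDisc.of D (AdjoinRoot.root D.poly)) (residueFieldCard F))
  (hf : IsLTSeries (CoeffDisc.of D (AdjoinRoot.root D.poly)) (residueFieldCard F)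
    (ltSeries (CoeffDisc.of D (AdjoinRoot.root D.poly)) (residueFieldCard F)))

include hπD in
/-- **`[a]_P ↦ [toInt a]_f`** under `𝒪_D → 𝒪_F` (both solve `f ∘ H = H ∘ f`, `H ≡ (toInt a)X`).
[cite: CasselsFrohlichANT1967, Ch. VI §3.5 Prop. 2] -/
theorem map_toInt_hom (a : CoeffDisc D) :
    (hom hA hf hf a).map (CoeffDisc.toInt D) =
      hom (isLTRing_integer F hπ) (isLTSeries_ltPoly F) (isLTSeries_ltPoly F) (CoeffDisc.toInt D a) := by
  have hs := map_toInt_ltSeries D hπD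
  have hf' : IsLTSeries π (residueFieldCard F)
      ((ltSeries (CoeffDisc.of D (AdjoinRoot.root D.poly)) (residueFieldCard F)).map (CoeffDisc.toInt D)) := by
    rw [hs]; exact isLTSeries_ltPoly F
  rw [map_hom (CoeffDisc.toInt D) hA hf hf (isLTRing_integer F hπ) hf' hf' a]
  exact hom_congr _ _ hf' hf' (isLTSeries_ltPoly F) (isLTSeries_ltPoly F) hs hs _

include hπD in
/-- `homC hπ (toInt a) = [a]_P` read on `𝒪̂_{F^nr}` through `𝒪_D → 𝒪_F → 𝒪̂_{F^nr}`. [cite: CasselsFrohlichANT1967, Ch. VI §3.5 Prop. 2] -/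
theorem homC_toInt (a : CoeffDisc D) :
    homC hπ (CoeffDisc.toInt D a) = (hom hA hf hf a).map ((intToUnrCoeff F).comp (CoeffDisc.toInt D)) := by
  rw [homC, ← map_toInt_hom D hπ hπD hA hf a, PowerSeries.map_comp, RingHom.comp_apply]

include hπD in
/-- ★ **`λ_f ∘ [a]_P = (toInt a)·λ_f`** over `F`: the Lubin–Tate logarithm is `𝒪_D`-linear for the `CoeffDisc D`-action
(tree `subst_hom_ltLog` transported along `[a]_P ↦ [toInt a]_f`). [cite: LubinTate1965, §1 Thm. 1 (9)] -/
theorem subst_map_hom_ltLog (a : CoeffDisc D) :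
    PowerSeries.subst ((hom hA hf hf a).map ((algebraMap 𝒪[F] F).comp (CoeffDisc.toInt D))) (ltLog hπ) =
      PowerSeries.C ((CoeffDisc.toInt D a : 𝒪[F]) : F) * ltLog hπ := by
  rw [PowerSeries.map_comp, RingHom.comp_apply, map_toInt_hom D hπ hπD hA hf a]
  exact subst_hom_ltLog hπ _

/-! ## §2 `[toInt a]_f(y) = [a]_P(y)` on `𝔪_{ℂ_F}` -/

include hπD in
/-- ★ **`[toInt a]_f(y) = [a]_P(y)` on `𝔪_{ℂ_F}`**: the tree's `homC`-action of `𝒪_F` and the `CoeffDisc D`-action `ltSMul`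
agree along `𝒪_D → 𝒪_F`. [cite: CasselsFrohlichANT1967, Ch. VI §3.5 Prop. 2] -/
theorem evalPt₁_homC_toInt (a : CoeffDisc D) (y : (maxNilIdealC F).toIdeal) :
    evalPt₁ (maxNilIdealC F) (homC hπ (CoeffDisc.toInt D a)) (constantCoeff_homC hπ _) y =
      ltSMul (maxNilIdealC F) hA hf a y := by
  have h1 : evalPt₁ (maxNilIdealC F) (homC hπ (CoeffDisc.toInt D a)) (constantCoeff_homC hπ _) y =
      evalPt₁ (maxNilIdealC F) ((hom hA hf hf a).map ((intToUnrCoeff F).comp (CoeffDisc.toInt D)))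
        (by rw [← homC_toInt D hπ hπD hA hf a]; exact constantCoeff_homC hπ _) y :=
    evalPt_congr (maxNilIdealC F) (homC_toInt D hπ hπD hA hf a) _ _ _
  rw [h1]
  unfold ltSMul
  exact evalPt₁_map_of_algebraMap_eq _ (CoeffDisc.algebraMap_intToUnrCoeff_toInt D) (maxNilIdealC F) _
    (constantCoeff_hom hA hf hf a) _ y

/-! ## §3 The tower `t = ltDivTower hπ` with coefficients in `𝒪_D` -/

include hπD in
/-- **`P(t_{n+1}) = t_n`** for the Lubin–Tate tower read with coefficients `𝒪_D` (`π = D.root`): the hypothesis `htp` of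
Fontaine's element `ltTorsionLift`. [cite: deShalit1987, Ch. I §2.2] -/
theorem ltStepC_ltDivTower_succ (n : ℕ) :
    AinfRamTop.ltStepC (D := D) (CoeffDisc.of D (AdjoinRoot.root D.poly)) (residueFieldCard_ne_zero F)
        (ltDivTower hπ (n + 1)) = ltDivTower hπ n := by
  apply Subtype.ext
  apply Subtype.ext
  rw [AinfRamTop.coe_ltStepC, Subring.coe_add, Subring.coe_mul, SubmonoidClass.coe_pow, coe_algebraMap_coeffDisc_cBall,
    Coeff.toF_root, ← hπD]
  exact ltPoly_ltDivTower_succ hπ n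

include hπD in
/-- ★ **`σ t_n = [a]_P t_n` whenever `toInt a = χ_π(σ)`**: the hypothesis `hσ` of `gal_ltTorsionLift_of_galSeq_eq` for the
Lubin–Tate tower (`σ t_n = [χ_π(σ)]_f t_n`, tree `galCBall_ltDivTower`). [cite: CasselsFrohlichANT1967, Ch. VI §3.4 Thm. 3 (b)] -/
theorem galSeq_ltDivTower (σ : absoluteGaloisGroup F) {a : CoeffDisc D}
    (ha : CoeffDisc.toInt D a = (lubinTateChar hπ σ : 𝒪[F])) (n : ℕ) :
    AinfTop.galSeq F σ (ltDivTower hπ) n = ltSMul (maxNilIdealC F) hA hf a (ltDivTower hπ n) := by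
  rw [← evalPt₁_homC_toInt D hπ hπD hA hf a]
  apply Subtype.ext
  rw [AinfTop.coe_galSeq, galCBall_ltDivTower hπ σ n]
  exact congrArg Subtype.val (evalPt_congr (maxNilIdealC F) (by rw [ha]) _ _ _)

include hπD in
/-- Functional form: `σ t = [a]_P t` as sequences. [cite: CasselsFrohlichANT1967, Ch. VI §3.4 Thm. 3 (b)] -/
theorem galSeq_ltDivTower_eq (σ : absoluteGaloisGroup F) {a : CoeffDisc D}
    (ha : CoeffDisc.toInt D a = (lubinTateChar hπ σ : 𝒪[F])) :
    AinfTop.galSeq F σ (ltDivTower hπ) = fun n => ltSMul (maxNilIdealC F) hA hf a (ltDivTower hπ n) :=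
  funext (galSeq_ltDivTower D hπ hπD hA hf σ ha)

end EisensteinRoot

end Literature.NumberTheory.PAdicHodge

end
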